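import Literature.MathematicalPhysics.QuantumFieldTheory.Balaban1983to89.B6Prop22TwoLevelBox

/-!
# `Balaban1983to89.B6Prop22DerivTwoLevelBox` — [B6] Proposition 2.2, SECOND ENTRY of (2.67),
`|(∇G′λ)(x)| ≤ O(1)L^jηe^{−½δ₀d(y,y′)}|λ|`, ALONG THE PRINTED ROUTE («The similar inequalities hold for a derivative of
G′λ …, but with (L^jη)² replaced by L^jη») FOR THE GENUINE TWO-LEVEL OPERATOR `Δ_Ω^{L^{−j},N} + m² + Q′*aQ′` ON A BOX OF
`L`-BLOCKS — uniformly in the mesh and the volume (file 5 of the two-level parametrix; nothing existing is touched; no fact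
is minted)

FRAMING (verbatim cell line):
statement-level skeleton of published theorems with citation tags; proofs where landed; nothing here is a claim about the Yang–Mills mass gap

Source under audit (cell pub-balaban): T. Bałaban, *Propagators and renormalization transformations for lattice gauge
theories. II*, Commun. Math. Phys. **96** (1984) 223–250 [`Balaban1984PropagatorsII`, "B6"], p. 234 [PDF 12] (2.64)–(2.67),
Proposition 2.2 (render `b2b-balaban-ref1/pages/1984-cmp96-propagators-rt-II/…-p012-x2.png`, read as an image this
generation); the derivative clause of [3] = T. Bałaban, Commun. Math. Phys. **89** (1983) Theorem (1.10) p. 573 enters BY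
NAME through gen-7's `B6Ineq243TwoLevelBox.ineq243_twoLevel_deriv_wsum`.

## WHAT IS PRINTED (p. 234, verbatim up to notation)

«The similar inequalities hold for a derivative of G′λ and for a Hölder norm of a derivative, but with (L^jη)² replaced
by L^jη and (L^jη)^{1−α} correspondingly. … Proposition 2.2. … |(∇G′λ)(x)| ≤ O(1)L^jηe^{−½δ₀d(y,y′)}|λ| … x ∈ B^j(y),
supp λ ⊂ B^{j′}(y′) (2.67). The expansion (2.50) is convergent … in the norms defined by the above inequalities.»

## WHAT THIS FILE CERTIFIES (kernel-checked; `A = 0`; the lineage is USED, not re-proved)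

Setting and notation of `B6Prop22TwoLevelBox` (`n = L^k`, `M = L·M_h`, `G′ = gTwoLevel`, `G′₀`, `R`).  The derivative
norm «defined by the above inequalities» is the weighted functional of the DIFFERENCED ROW
`wsum_{δ,x}(n(G′(x+e_μ,·) − G′(x,·))) = Σ_{x′}|n(G′(x+e_μ,x′) − G′(x,x′))|e^{δ|x−x′|_∞/n}` (`B4Thm110ZeroBoxDeriv.wsum`;
`n(φ(x+e_μ) − φ(x)) = (∂^{L^{−j}}_μφ)(x)` on the fine lattice).
* §1 bookkeeping for `wsum` (monotone in the rate, finite sums, shifted base point, one entry, padded differenced rows);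
* §2 **the (2.64)-input, derivative**: `wsum_gZero_deriv_le` — for neighbours `x, x+e_μ ∈ Ω`,
  `wsum_{δ,x}(n(G′₀(x+e_μ,·) − G′₀(x,·))) ≤ C₀` uniformly (mesh `k ≥ 1`, `M_h ≥ 1`, volume, block union, window): by the
  product rule `n(h_qĜ_qh_q)(x+e_μ,·) − … = n(h_q(x+e_μ) − h_q(x))Ĝ_q(x+e_μ,·)h_q + h_q(x)·n(Ĝ_q(x+e_μ,·) − Ĝ_q(x,·))h_q`,
  the unit-scale size `n|h_q(x+e_μ) − h_q(x)| ≤ κ₁` (`B6Partition236TwoLevelBox.abs_hq_sub_le`), (2.43)₁ on the cut cube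
  (`ineq243_twoLevel_roww`), the DIFFERENCED (2.43) on the cut cube (`ineq243_twoLevel_deriv_wsum`) — applicable because
  `h_q(x) ≠ 0` puts `x` off the internal layer, so `x + e_μ` lies in the same cube (`B6Eq238TwoLevelBox.hΩ_support`,
  `exists_emb_eq_of_nbr`) — and the finite overlap (`≤ 2^{d+2}` cubes meet `x` or `x + e_μ`);
* §3 **(2.67)₂ ALONG THE PRINTED ROUTE** `prop22_entry2_twoLevelBox`: there are `δ, M₀, C > 0` (functions of `d`, `ℓ`,
  window) such that for EVERY `k ≥ 1`, `M_h ≥ 3` with `L·M_h ≥ M₀`, volume, block union, window point, axis `μ` and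
  neighbours `x, x + e_μ ∈ Ω`: `wsum_{δ,x}(n(G′(x+e_μ,·) − G′(x,·))) ≤ C` — from the differenced fixed-point form
  `n(G′(x+e_μ,·) − G′(x,·)) = n(G′₀(x+e_μ,·) − G′₀(x,·)) + [n(G′(x+e_μ,·) − G′(x,·))]·R` (`B6Prop22TwoLevelBox.gTwoLevel_eq_gZero_add`),
  `wsum(v·R) ≤ wsum(v)·sup roww(R)` (`B6Ineq243TwoLevelBox.wsum_vecMul_le`) and `sup roww(R) ≤ C_R/M ≤ ½`
  (`B6Prop22TwoLevelBox.roww_rOp_le`); and the printed value form `gTwoLevel_deriv_value_decay`: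
  `|n((G′λ)(x+e_μ) − (G′λ)(x))| ≤ Ce^{−δD/n}F` for `|λ| ≤ F` supported at sup-distance `≥ D` from `x`.

## HONEST SCOPE

As in `B6Prop22TwoLevelBox`: `k = 1`, `A = 0`, Neumann box, one cube size, existential constants; AS A BOUND the result
is one line from the differenced (2.43) on `Ω` itself (`ineq243_twoLevel_deriv_wsum`); certified is the printed ROUTE.
The third entry `G′∇*λ` and the Hölder entries of (2.67) are not treated.  Every step is kernel-checked.
-/

namespace Literature.MathematicalPhysics.QuantumFieldTheory.Balaban1983to89.B6Prop22DerivTwoLevelBox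

open Finset Matrix
open Literature.MathematicalPhysics.QuantumFieldTheory.Balaban1983to89.B4Reflection242 (boxDom mem_boxDom nbrs mem_nbrs)
open Literature.MathematicalPhysics.QuantumFieldTheory.Balaban1983to89.B4ContourShift (supNorm supNorm_nonneg)
open Literature.MathematicalPhysics.QuantumFieldTheory.Balaban1983to89.B4Lemma22ReduceZero (Box)
open Literature.MathematicalPhysics.QuantumFieldTheory.Balaban1983to89.B4Thm110ZeroBox (roww roww_nonneg
  supNorm_sub_le_sub_add_sub)
open Literature.MathematicalPhysics.QuantumFieldTheory.Balaban1983to89.B4Thm110ZeroBoxDeriv (wsum wsum_nonneg wsum_add_le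
  wsum_mul_left abs_sum_mul_le_of_wsum mulVec_sub_mulVec supNorm_single_le)
open Literature.MathematicalPhysics.QuantumFieldTheory.Balaban1983to89.B4PartitionUnity22 (hprof D1 D1_nonneg
  contDiff_hprof hasCompactSupport_hprof)
open Literature.MathematicalPhysics.QuantumFieldTheory.Balaban1983to89.B6Ineq243TwoLevelBox
open Literature.MathematicalPhysics.QuantumFieldTheory.Balaban1983to89.B6Partition236TwoLevelBox
open Literature.MathematicalPhysics.QuantumFieldTheory.Balaban1983to89.B6Eq238TwoLevelBox
open Literature.MathematicalPhysics.QuantumFieldTheory.Balaban1983to89.B6Ineq249TwoLevelBox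
open Literature.MathematicalPhysics.QuantumFieldTheory.Balaban1983to89.B6Prop22TwoLevelBox

noncomputable section

variable {d : ℕ}

/-! ## §1 Bookkeeping for the weighted functional of a differenced row -/

section WsumTools

variable {N : Fin (d + 1) → ℕ}

/-- `wsum` is monotone in the rate. [folklore] -/
private theorem wsum_mono {δ δ' : ℝ} (h : δ' ≤ δ) (n : ℕ) (x : ↥(boxDom N)) (g : ↥(boxDom N) → ℝ) :
    wsum δ' n x g ≤ wsum δ n x g := by
  unfold wsum
  refine Finset.sum_le_sum fun x' _ => mul_le_mul_of_nonneg_left ?_ (abs_nonneg _)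
  exact Real.exp_le_exp.2 (div_le_div_of_nonneg_right
    (mul_le_mul_of_nonneg_right h (supNorm_nonneg _)) (Nat.cast_nonneg n))

/-- `wsum` depends only on the function. [folklore] -/
private theorem wsum_congr (δ : ℝ) (n : ℕ) (x : ↥(boxDom N)) {g g' : ↥(boxDom N) → ℝ} (h : ∀ x', g x' = g' x') :
    wsum δ n x g = wsum δ n x g' := by
  unfold wsum
  exact Finset.sum_congr rfl fun x' _ => by rw [h x']

/-- `wsum` of a finite sum of functions. [folklore] -/
private theorem wsum_sum_le {ι : Type*} (s : Finset ι) (δ : ℝ) (n : ℕ) (x : ↥(boxDom N))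
    (g : ι → ↥(boxDom N) → ℝ) : wsum δ n x (fun x' => ∑ i ∈ s, g i x') ≤ ∑ i ∈ s, wsum δ n x (g i) := by
  classical
  induction s using Finset.induction_on with
  | empty =>
      simp only [Finset.sum_empty]
      unfold wsum
      simp
  | insert i s hi ih =>
      rw [Finset.sum_insert hi]
      have e : (fun x' => ∑ j ∈ insert i s, g j x') = fun x' => g i x' + ∑ j ∈ s, g j x' :=
        funext fun x' => Finset.sum_insert hi
      rw [e]
      exact (wsum_add_le δ n x _ _).trans (by linarith)

/-- shifting the base point by `≤ 1` costs a factor `e^{δ}` (`n ≥ 1`, `δ ≥ 0`). [folklore] -/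
private theorem wsum_shift_le {δ : ℝ} (hδ : 0 ≤ δ) {n : ℕ} (hn : 1 ≤ n) (x xe : ↥(boxDom N))
    (hxe : supNorm (x.1 - xe.1) ≤ 1) (g : ↥(boxDom N) → ℝ) :
    wsum δ n x g ≤ Real.exp δ * wsum δ n xe g := by
  have hn' : (1 : ℝ) ≤ n := by exact_mod_cast hn
  unfold wsum
  rw [Finset.mul_sum]
  refine Finset.sum_le_sum fun x' _ => ?_
  rw [mul_left_comm]
  refine mul_le_mul_of_nonneg_left ?_ (abs_nonneg _)
  rw [← Real.exp_add]
  apply Real.exp_le_exp.2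
  have htri := supNorm_sub_le_sub_add_sub x.1 xe.1 x'.1
  have h1 : δ * supNorm (x.1 - x'.1) / n ≤ δ * (1 + supNorm (xe.1 - x'.1)) / n :=
    div_le_div_of_nonneg_right (mul_le_mul_of_nonneg_left (by linarith) hδ) (Nat.cast_nonneg n)
  have h2 : δ * (1 + supNorm (xe.1 - x'.1)) / n = δ / n + δ * supNorm (xe.1 - x'.1) / n := by ring
  have h3 : δ / n ≤ δ := div_le_self hδ hn'
  linarith

/-- comparison: `|g| ≤ c|g′|` pointwise gives `wsum(g) ≤ c·wsum(g′)`. [folklore] -/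
private theorem wsum_le_mul_of_abs_le (δ : ℝ) (n : ℕ) (x : ↥(boxDom N)) {g g' : ↥(boxDom N) → ℝ} {c : ℝ}
    (h : ∀ x', |g x'| ≤ c * |g' x'|) : wsum δ n x g ≤ c * wsum δ n x g' := by
  unfold wsum
  rw [Finset.mul_sum]
  refine Finset.sum_le_sum fun x' _ => ?_
  rw [← mul_assoc]
  exact mul_le_mul_of_nonneg_right (h x') (Real.exp_pos _).le

/-- the differenced row of a padded cube kernel at an embedded pair is the differenced row on the cube.
[cite: Balaban1983RegularityDecay, §2 p.575, dictionary] -/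
theorem wsum_pad_emb_pair {ℓ k Mh : ℕ} {P : Fin (d + 1) → ℕ} {q : Fin (d + 1) → ℤ} (hP : ∀ i, 1 ≤ P i) (hq : q ∈ ctrs P)
    (δ : ℝ) (n : ℕ) (t : ℝ)
    (T : Matrix ↥(Box d ℓ k (fun i => (ℓ + 1) * cubeM' Mh P q i)) ↥(Box d ℓ k (fun i => (ℓ + 1) * cubeM' Mh P q i)) ℝ)
    (a ae : ↥(Box d ℓ k (fun i => (ℓ + 1) * cubeM' Mh P q i))) :
    wsum δ n (emb ℓ k Mh P q hP hq a) (fun x' =>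
        t * (((res (emb ℓ k Mh P q hP hq))ᵀ * T * res (emb ℓ k Mh P q hP hq)) (emb ℓ k Mh P q hP hq ae) x'
          - ((res (emb ℓ k Mh P q hP hq))ᵀ * T * res (emb ℓ k Mh P q hP hq)) (emb ℓ k Mh P q hP hq a) x'))
      = wsum δ n a (fun b => t * (T ae b - T a b)) := by
  have hinj := emb_injective (ℓ := ℓ) (k := k) (Mh := Mh) hP hq
  unfold wsum
  have hoff : ∀ x' ∈ (Finset.univ : Finset ↥(Box d ℓ k (fun i => (ℓ + 1) * (Mh * P i)))),
      x' ∉ Finset.univ.image (emb ℓ k Mh P q hP hq) →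
      |t * (((res (emb ℓ k Mh P q hP hq))ᵀ * T * res (emb ℓ k Mh P q hP hq)) (emb ℓ k Mh P q hP hq ae) x'
          - ((res (emb ℓ k Mh P q hP hq))ᵀ * T * res (emb ℓ k Mh P q hP hq)) (emb ℓ k Mh P q hP hq a) x')|
        * Real.exp (δ * supNorm ((emb ℓ k Mh P q hP hq a).1 - x'.1) / n) = 0 := by
    intro x' _ hx'
    have hne : ∀ b, emb ℓ k Mh P q hP hq b ≠ x' := fun b hb =>
      hx' (Finset.mem_image.2 ⟨b, Finset.mem_univ _, hb⟩)
    rw [mul_res_apply_off _ _ _ hne, mul_res_apply_off _ _ _ hne, sub_zero, mul_zero, abs_zero, zero_mul]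
  rw [← Finset.sum_subset (Finset.subset_univ _) hoff, Finset.sum_image (fun b _ b' _ h => hinj h)]
  refine Finset.sum_congr rfl fun b _ => ?_
  rw [Matrix.mul_assoc, transpose_res_mul_apply_img hinj, transpose_res_mul_apply_img hinj, mul_res_apply_img hinj,
    mul_res_apply_img hinj, emb_sub_emb hP hq]

/-- a sum of non-negative terms, each `≤ B`, non-zero only on terms indexed injectively by `T`: `≤ |T|·B`. [folklore] -/
private theorem sum_le_card_mul'' {ι σ : Type*} [Fintype ι] [DecidableEq σ] (f : ι → ℝ) (key : ι → σ)
    (hkey : Function.Injective key) (T : Finset σ) (hT : ∀ i, f i ≠ 0 → key i ∈ T) {B : ℝ} (hB : 0 ≤ B)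
    (hf : ∀ i, f i ≤ B) : ∑ i, f i ≤ T.card * B := by
  classical
  rw [← Finset.sum_filter_ne_zero]
  have hcard : (Finset.univ.filter fun i => f i ≠ 0).card ≤ T.card :=
    Finset.card_le_card_of_injOn key (fun i hi => by
      rw [Finset.coe_filter] at hi; exact hT i hi.2) (fun i _ j _ h => hkey h)
  calc ∑ i ∈ Finset.univ.filter (fun i => f i ≠ 0), f i
      ≤ (Finset.univ.filter fun i => f i ≠ 0).card • B := Finset.sum_le_card_nsmul _ _ _ fun i _ => hf i
    _ = ((Finset.univ.filter fun i => f i ≠ 0).card : ℝ) * B := by rw [nsmul_eq_mul]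
    _ ≤ T.card * B := by gcongr

end WsumTools

/-! ## §2 The (2.64)-input for the derivative: the differenced rows of `G′₀` -/

section GZeroDeriv

variable {ℓ k Mh : ℕ} {P : Fin (d + 1) → ℕ}

/-- a neighbour `x + e_μ` of a site carrying `h_q` lies in the cube `□_q` together with it (the site is off the internal
layer). [cite: Balaban1983RegularityDecay, (2.6) p.576] -/
theorem exists_emb_pair_of_hΩ_ne_zero (hℓ : 1 ≤ ℓ) (hk : 1 ≤ k) (hMh : 1 ≤ Mh) (hP : ∀ i, 1 ≤ P i)
    {q : Fin (d + 1) → ℤ} (hq : q ∈ ctrs P) {μ : Fin (d + 1)}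
    {x xe : ↥(Box d ℓ k (fun i => (ℓ + 1) * (Mh * P i)))} (hxe : xe.1 = x.1 + Pi.single μ 1)
    (hx : hΩ ℓ k Mh P q x ≠ 0) :
    ∃ a ae : ↥(Box d ℓ k (fun i => (ℓ + 1) * cubeM' Mh P q i)),
      emb ℓ k Mh P q hP hq a = x ∧ emb ℓ k Mh P q hP hq ae = xe ∧ ae.1 = a.1 + Pi.single μ 1 := by
  obtain ⟨a, rfl, ha⟩ := hΩ_support hℓ hk hMh hP hq x hx
  obtain ⟨ae, hae⟩ := exists_emb_eq_of_nbr hP hq ha (x := xe) (mem_nbrs.2 ⟨μ, Or.inl hxe⟩)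
  refine ⟨a, ae, rfl, hae, ?_⟩
  have h := emb_sub_emb hP hq ae a
  rw [hae, hxe, add_sub_cancel_left] at h
  rw [h, add_sub_cancel]

/-- **THE DIFFERENCED ROWS OF `G′₀`**: for neighbours `x, x + e_μ ∈ Ω`, `wsum_{δ,x}(n(G′₀(x+e_μ,·) − G′₀(x,·))) ≤ C₀`
uniformly (product rule + `n|h_q(x+e_μ) − h_q(x)| ≤ κ₁` + (2.43)₁ and differenced (2.43) on the cut cubes + finite
overlap). [cite: Balaban1984PropagatorsII, (2.64) p.234 (derivative clause), (2.43) p.230] -/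
theorem wsum_gZero_deriv_le (d ℓ : ℕ) (hℓ : 1 ≤ ℓ) (aminus aplus m2plus a2minus a2plus : ℝ) (ha : 0 < aminus)
    (ha2 : 0 < a2minus) :
    ∃ δ₂ C₀ : ℝ, 0 < δ₂ ∧ 0 < C₀ ∧ ∀ (k : ℕ), 1 ≤ k → ∀ (aj m2 a : ℝ), aminus ≤ aj → aj ≤ aplus → 0 ≤ m2 →
      m2 ≤ m2plus → a2minus ≤ a → a ≤ a2plus → ∀ (Mh : ℕ), 1 ≤ Mh → ∀ (P : Fin (d + 1) → ℕ) (hP : ∀ i, 1 ≤ P i)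
        (Λ : Finset ↥(boxDom (fun i => (ℓ + 1) * (Mh * P i)))) (μ : Fin (d + 1))
        (x xe : ↥(Box d ℓ k (fun i => (ℓ + 1) * (Mh * P i)))), xe.1 = x.1 + Pi.single μ 1 →
          wsum δ₂ ((ℓ + 1) ^ k) x (fun x' => (((ℓ + 1) ^ k : ℕ) : ℝ)
              * (B6Eq250.gZero (hDiag ℓ k Mh P) (gPad ℓ k Mh P aj a m2 Λ hP) xe x'
                - B6Eq250.gZero (hDiag ℓ k Mh P) (gPad ℓ k Mh P aj a m2 Λ hP) x x')) ≤ C₀ := by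
  obtain ⟨δa, c', hδa, hc', h243⟩ := ineq243_twoLevel_roww d ℓ hℓ aminus aplus m2plus a2minus a2plus ha ha2
  obtain ⟨δb, cd, hδb, hcd, h243d⟩ := ineq243_twoLevel_deriv_wsum d ℓ hℓ aminus aplus m2plus a2minus a2plus ha ha2
  have hD1 := D1_nonneg contDiff_hprof hasCompactSupport_hprof
  set δ₂ : ℝ := min δa δb with hδ₂
  have hδ₂0 : 0 < δ₂ := lt_min hδa hδb
  -- per-cube bounds: first term `B₁`, second term `B₂`
  set B₁ : ℝ := (d + 1) * D1 hprof * (Real.exp δ₂ * c') with hB₁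
  set B₂ : ℝ := cd with hB₂
  have hB₁0 : 0 ≤ B₁ := by
    rw [hB₁]
    exact mul_nonneg (mul_nonneg (by positivity) hD1) (mul_nonneg (Real.exp_pos _).le hc'.le)
  have hB₂0 : 0 ≤ B₂ := hcd.le
  have hC₀pos : 0 < (2 ^ (d + 1) + 2 ^ (d + 1)) * (B₁ + B₂) + 1 :=
    add_pos_of_nonneg_of_pos (mul_nonneg (by positivity) (add_nonneg hB₁0 hB₂0)) one_pos
  refine ⟨δ₂, (2 ^ (d + 1) + 2 ^ (d + 1)) * (B₁ + B₂) + 1, hδ₂0, hC₀pos, ?_⟩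
  intro k hk aj m2 a e1 e2 e3 e4 e5 e6 Mh hMh P hP Λ μ x xe hxe
  have hn1 : 1 ≤ (ℓ + 1) ^ k := Nat.one_le_pow _ _ (by omega)
  have hN1 : 1 ≤ (ℓ + 1) ^ k * ((ℓ + 1) * Mh) := Nat.one_le_iff_ne_zero.2 (by positivity)
  have hNr : (0 : ℝ) < (((ℓ + 1) ^ k * ((ℓ + 1) * Mh) : ℕ) : ℝ) := by exact_mod_cast hN1
  have hnr : (0 : ℝ) < (((ℓ + 1) ^ k : ℕ) : ℝ) := by exact_mod_cast hn1
  have hM1 : (1 : ℝ) ≤ ((ℓ : ℝ) + 1) * Mh := by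
    have : (1 : ℝ) ≤ Mh := by exact_mod_cast hMh
    have : (0 : ℝ) ≤ ℓ := Nat.cast_nonneg ℓ
    nlinarith
  have hxxe : supNorm (x.1 - xe.1) ≤ 1 := by
    rw [hxe, show x.1 - (x.1 + Pi.single μ 1) = -(Pi.single μ (1 : ℤ) : Fin (d + 1) → ℤ) by abel,
      B4TorusKernel.supNorm_neg]
    exact supNorm_single_le μ
  set G₀ := B6Eq250.gZero (hDiag ℓ k Mh P) (gPad ℓ k Mh P aj a m2 Λ hP) with hG₀
  -- abbreviations per cube
  have hM' : ∀ q : ↥(ctrs P), ∀ i, 1 ≤ cubeM' Mh P q.1 i := fun q i =>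
    Nat.one_le_iff_ne_zero.2 (Nat.mul_ne_zero_iff.2 ⟨by omega, by have := (one_le_cubeW hP q.2 i).1; omega⟩)
  -- the two pieces of the product rule, per cube
  obtain ⟨f₁, hf₁⟩ : ∃ f₁ : ↥(ctrs P) → ↥(Box d ℓ k (fun i => (ℓ + 1) * (Mh * P i))) → ℝ, f₁ = fun q x' =>
      ((((ℓ + 1) ^ k : ℕ) : ℝ)) * (hΩ ℓ k Mh P q.1 xe - hΩ ℓ k Mh P q.1 x) * gPad ℓ k Mh P aj a m2 Λ hP q xe x' * hΩ ℓ k Mh P q.1 x' :=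
    ⟨_, rfl⟩
  obtain ⟨f₂, hf₂⟩ : ∃ f₂ : ↥(ctrs P) → ↥(Box d ℓ k (fun i => (ℓ + 1) * (Mh * P i))) → ℝ, f₂ = fun q x' =>
      hΩ ℓ k Mh P q.1 x * (((((ℓ + 1) ^ k : ℕ) : ℝ)) * (gPad ℓ k Mh P aj a m2 Λ hP q xe x' - gPad ℓ k Mh P aj a m2 Λ hP q x x'))
        * hΩ ℓ k Mh P q.1 x' := ⟨_, rfl⟩
  have hsplit : ∀ x', ((((ℓ + 1) ^ k : ℕ) : ℝ)) * (G₀ xe x' - G₀ x x') = ∑ q : ↥(ctrs P), (f₁ q x' + f₂ q x') := by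
    intro x'
    rw [hG₀, B6Eq250.gZero_eq_sum_aTerm, Matrix.sum_apply, Matrix.sum_apply, ← Finset.sum_sub_distrib, Finset.mul_sum]
    refine Finset.sum_congr rfl fun q _ => ?_
    rw [B6Eq250.aTerm_apply, hf₁, hf₂]
    unfold hDiag
    simp only [Matrix.mul_diagonal, Matrix.diagonal_mul]
    ring
  -- bound of the first piece
  have hfirst : ∀ q : ↥(ctrs P), wsum δ₂ ((ℓ + 1) ^ k) x (f₁ q) ≤ B₁ := by
    intro q
    have hdh : |((((ℓ + 1) ^ k : ℕ) : ℝ)) * (hΩ ℓ k Mh P q.1 xe - hΩ ℓ k Mh P q.1 x)| ≤ (d + 1) * D1 hprof := by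
      have h := abs_hq_sub_le (d := d) hn1 (Nat.one_le_iff_ne_zero.2 (by positivity : (ℓ + 1) * Mh ≠ 0)) q.1 x.1 xe.1
      unfold hΩ
      rw [abs_mul, abs_of_nonneg (Nat.cast_nonneg _)]
      have hs : supNorm (xe.1 - x.1) ≤ 1 := by rw [hxe, add_sub_cancel_left]; exact supNorm_single_le μ
      have hM' : (1 : ℝ) ≤ (((ℓ + 1) * Mh : ℕ) : ℝ) := by push_cast; exact hM1
      calc ((((ℓ + 1) ^ k : ℕ) : ℝ)) * |hq ((ℓ + 1) ^ k) ((ℓ + 1) * Mh) q.1 xe.1 - hq ((ℓ + 1) ^ k) ((ℓ + 1) * Mh) q.1 x.1|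
          ≤ ((((ℓ + 1) ^ k : ℕ) : ℝ)) * ((d + 1) * D1 hprof / (((ℓ + 1) * Mh : ℕ) : ℝ) * supNorm (xe.1 - x.1)
              / ((((ℓ + 1) ^ k : ℕ) : ℝ))) :=
            mul_le_mul_of_nonneg_left h (Nat.cast_nonneg _)
        _ = (d + 1) * D1 hprof / (((ℓ + 1) * Mh : ℕ) : ℝ) * supNorm (xe.1 - x.1) := by
            field_simp
        _ ≤ (d + 1) * D1 hprof / (((ℓ + 1) * Mh : ℕ) : ℝ) * 1 :=
            mul_le_mul_of_nonneg_left hs (div_nonneg (mul_nonneg (by positivity) hD1) (Nat.cast_nonneg _))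
        _ ≤ (d + 1) * D1 hprof := by
            rw [mul_one]; exact div_le_self (mul_nonneg (by positivity) hD1) hM'
    -- `wsum_x(c·Ĝ(xe,·)·h) ≤ |c|·e^{δ}·roww(Ĝ)(xe)`
    have hrow : roww δ₂ ((ℓ + 1) ^ k) (gPad ℓ k Mh P aj a m2 Λ hP q) xe ≤ c' := by
      unfold gPad cubeG
      by_cases hxe' : ∃ b, emb ℓ k Mh P q.1 hP q.2 b = xe
      · obtain ⟨b, hb⟩ := hxe'
        rw [← hb, roww_pad_emb hP q.2]
        exact (roww_mono (min_le_left _ _) _ _ _).trans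
          (h243 k hk aj m2 a e1 e2 e3 e4 e5 e6 (cubeM' Mh P q.1) (hM' q) (lamLoc ℓ Mh P q.1 hP q.2 Λ) b)
      · push Not at hxe'
        rw [roww_pad_off hP q.2 _ _ _ hxe']
        exact hc'.le
    have hstep : wsum δ₂ ((ℓ + 1) ^ k) x (f₁ q)
        ≤ |((((ℓ + 1) ^ k : ℕ) : ℝ)) * (hΩ ℓ k Mh P q.1 xe - hΩ ℓ k Mh P q.1 x)| * wsum δ₂ ((ℓ + 1) ^ k) x (fun x' => gPad ℓ k Mh P aj a m2 Λ hP q xe x') := by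
      refine wsum_le_mul_of_abs_le _ _ _ fun x' => ?_
      rw [hf₁]
      simp only
      rw [abs_mul, abs_mul]
      calc |((((ℓ + 1) ^ k : ℕ) : ℝ)) * (hΩ ℓ k Mh P q.1 xe - hΩ ℓ k Mh P q.1 x)| * |gPad ℓ k Mh P aj a m2 Λ hP q xe x'| * |hΩ ℓ k Mh P q.1 x'|
          ≤ |((((ℓ + 1) ^ k : ℕ) : ℝ)) * (hΩ ℓ k Mh P q.1 xe - hΩ ℓ k Mh P q.1 x)| * |gPad ℓ k Mh P aj a m2 Λ hP q xe x'| * 1 :=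
            mul_le_mul_of_nonneg_left (abs_hq_le_one _ _ _ _) (by positivity)
        _ = |((((ℓ + 1) ^ k : ℕ) : ℝ)) * (hΩ ℓ k Mh P q.1 xe - hΩ ℓ k Mh P q.1 x)| * |gPad ℓ k Mh P aj a m2 Λ hP q xe x'| := mul_one _
    have hshift : wsum δ₂ ((ℓ + 1) ^ k) x (fun x' => gPad ℓ k Mh P aj a m2 Λ hP q xe x') ≤ Real.exp δ₂ * c' :=
      (wsum_shift_le hδ₂0.le hn1 x xe hxxe _).trans (mul_le_mul_of_nonneg_left hrow (Real.exp_pos _).le)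
    calc wsum δ₂ ((ℓ + 1) ^ k) x (f₁ q) ≤ |((((ℓ + 1) ^ k : ℕ) : ℝ)) * (hΩ ℓ k Mh P q.1 xe - hΩ ℓ k Mh P q.1 x)|
          * wsum δ₂ ((ℓ + 1) ^ k) x (fun x' => gPad ℓ k Mh P aj a m2 Λ hP q xe x') := hstep
      _ ≤ ((d + 1) * D1 hprof) * (Real.exp δ₂ * c') :=
          mul_le_mul hdh hshift (wsum_nonneg _ _ _ _) (mul_nonneg (by positivity) hD1)
      _ = B₁ := by rw [hB₁]
  -- bound of the second piece
  have hsecond : ∀ q : ↥(ctrs P), wsum δ₂ ((ℓ + 1) ^ k) x (f₂ q) ≤ |hΩ ℓ k Mh P q.1 x| * B₂ := by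
    intro q
    have hstep : wsum δ₂ ((ℓ + 1) ^ k) x (f₂ q) ≤ |hΩ ℓ k Mh P q.1 x| * wsum δ₂ ((ℓ + 1) ^ k) x (fun x' =>
        ((((ℓ + 1) ^ k : ℕ) : ℝ)) * (gPad ℓ k Mh P aj a m2 Λ hP q xe x' - gPad ℓ k Mh P aj a m2 Λ hP q x x')) := by
      refine wsum_le_mul_of_abs_le _ _ _ fun x' => ?_
      rw [hf₂]
      simp only
      rw [abs_mul, abs_mul]
      calc |hΩ ℓ k Mh P q.1 x| * |((((ℓ + 1) ^ k : ℕ) : ℝ)) * (gPad ℓ k Mh P aj a m2 Λ hP q xe x' - gPad ℓ k Mh P aj a m2 Λ hP q x x')|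
            * |hΩ ℓ k Mh P q.1 x'|
          ≤ |hΩ ℓ k Mh P q.1 x| * |((((ℓ + 1) ^ k : ℕ) : ℝ)) * (gPad ℓ k Mh P aj a m2 Λ hP q xe x' - gPad ℓ k Mh P aj a m2 Λ hP q x x')|
            * 1 := mul_le_mul_of_nonneg_left (abs_hq_le_one _ _ _ _) (by positivity)
        _ = _ := mul_one _
    refine hstep.trans ?_
    by_cases hx0 : hΩ ℓ k Mh P q.1 x = 0
    · rw [hx0, abs_zero, zero_mul, zero_mul]
    · refine mul_le_mul_of_nonneg_left ?_ (abs_nonneg _)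
      obtain ⟨a', ae, rfl, rfl, hae⟩ := exists_emb_pair_of_hΩ_ne_zero hℓ hk hMh hP q.2 hxe hx0
      unfold gPad cubeG
      rw [wsum_pad_emb_pair hP q.2]
      have h : wsum δb ((ℓ + 1) ^ k) a' (fun b => ((((ℓ + 1) ^ k : ℕ) : ℝ)) * (gTwoLevel ((ℓ + 1) ^ k) ℓ aj a m2 (cubeM' Mh P q.1) (lamLoc ℓ Mh P q.1 hP q.2 Λ) ae b
          - gTwoLevel ((ℓ + 1) ^ k) ℓ aj a m2 (cubeM' Mh P q.1) (lamLoc ℓ Mh P q.1 hP q.2 Λ) a' b)) ≤ B₂ :=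
        h243d k hk aj m2 a e1 e2 e3 e4 e5 e6 (cubeM' Mh P q.1) (hM' q) (lamLoc ℓ Mh P q.1 hP q.2 Λ) μ a' ae hae
      exact (wsum_mono (min_le_right _ _) _ _ _).trans h
  -- the overlap count: both pieces vanish unless `q ∈ near x ∪ near xe`
  have hT : ∀ q : ↥(ctrs P), (hΩ ℓ k Mh P q.1 x ≠ 0 ∨ hΩ ℓ k Mh P q.1 xe ≠ 0) →
      q.1 ∈ near ((ℓ + 1) ^ k * ((ℓ + 1) * Mh)) x.1 ∪ near ((ℓ + 1) ^ k * ((ℓ + 1) * Mh)) xe.1 := by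
    have h58 : 5 / 8 * (((ℓ + 1) ^ k * ((ℓ + 1) * Mh) : ℕ) : ℝ) < (((ℓ + 1) ^ k * ((ℓ + 1) * Mh) : ℕ) : ℝ) := by
      linarith
    rintro q (h0 | h0)
    · exact Finset.mem_union_left _ (mem_near_of_abs_lt hN1 fun ν => (abs_lt_of_hq_ne_zero hN1 h0 ν).trans h58)
    · exact Finset.mem_union_right _ (mem_near_of_abs_lt hN1 fun ν => (abs_lt_of_hq_ne_zero hN1 h0 ν).trans h58)
  have hcardU : ((near ((ℓ + 1) ^ k * ((ℓ + 1) * Mh)) x.1 ∪ near ((ℓ + 1) ^ k * ((ℓ + 1) * Mh)) xe.1).card : ℝ)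
      ≤ 2 ^ (d + 1) + 2 ^ (d + 1) := by
    have h1 := card_near_le ((ℓ + 1) ^ k * ((ℓ + 1) * Mh)) x.1
    have h2 := card_near_le ((ℓ + 1) ^ k * ((ℓ + 1) * Mh)) xe.1
    have h3 := Finset.card_union_le (near ((ℓ + 1) ^ k * ((ℓ + 1) * Mh)) x.1)
      (near ((ℓ + 1) ^ k * ((ℓ + 1) * Mh)) xe.1)
    have : ((near ((ℓ + 1) ^ k * ((ℓ + 1) * Mh)) x.1 ∪ near ((ℓ + 1) ^ k * ((ℓ + 1) * Mh)) xe.1).card : ℝ)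
        ≤ ((2 ^ (d + 1) + 2 ^ (d + 1) : ℕ) : ℝ) := by exact_mod_cast h3.trans (Nat.add_le_add h1 h2)
    push_cast at this
    exact this
  have key₁ := sum_le_card_mul'' (fun q : ↥(ctrs P) => wsum δ₂ ((ℓ + 1) ^ k) x (f₁ q)) (fun q => q.1) Subtype.val_injective
    (near ((ℓ + 1) ^ k * ((ℓ + 1) * Mh)) x.1 ∪ near ((ℓ + 1) ^ k * ((ℓ + 1) * Mh)) xe.1)
    (fun q hq0 => by
      refine hT q ?_
      by_contra hboth
      push Not at hboth
      apply hq0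
      unfold wsum
      refine Finset.sum_eq_zero fun x' _ => ?_
      rw [hf₁]
      simp only
      rw [hboth.1, hboth.2, sub_self, mul_zero, zero_mul, zero_mul, abs_zero, zero_mul])
    hB₁0 hfirst
  have key₂ := sum_le_card_mul'' (fun q : ↥(ctrs P) => wsum δ₂ ((ℓ + 1) ^ k) x (f₂ q)) (fun q => q.1) Subtype.val_injective
    (near ((ℓ + 1) ^ k * ((ℓ + 1) * Mh)) x.1 ∪ near ((ℓ + 1) ^ k * ((ℓ + 1) * Mh)) xe.1)
    (fun q hq0 => by
      refine hT q (Or.inl fun h0 => hq0 ?_)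
      exact le_antisymm ((hsecond q).trans (by rw [h0, abs_zero, zero_mul])) (wsum_nonneg _ _ _ _))
    hB₂0 (fun q => (hsecond q).trans (by
      calc |hΩ ℓ k Mh P q.1 x| * B₂ ≤ 1 * B₂ := mul_le_mul_of_nonneg_right (abs_hq_le_one _ _ _ _) hB₂0
        _ = B₂ := one_mul _))
  -- assembly
  rw [wsum_congr _ _ _ hsplit]
  have hsum : wsum δ₂ ((ℓ + 1) ^ k) x (fun x' => ∑ q : ↥(ctrs P), (f₁ q x' + f₂ q x'))
      ≤ ∑ q : ↥(ctrs P), wsum δ₂ ((ℓ + 1) ^ k) x (f₁ q) + ∑ q : ↥(ctrs P), wsum δ₂ ((ℓ + 1) ^ k) x (f₂ q) := by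
    calc wsum δ₂ ((ℓ + 1) ^ k) x (fun x' => ∑ q : ↥(ctrs P), (f₁ q x' + f₂ q x'))
        ≤ ∑ q : ↥(ctrs P), wsum δ₂ ((ℓ + 1) ^ k) x (fun x' => f₁ q x' + f₂ q x') :=
          wsum_sum_le Finset.univ δ₂ ((ℓ + 1) ^ k) x (fun q x' => f₁ q x' + f₂ q x')
      _ ≤ ∑ q : ↥(ctrs P), (wsum δ₂ ((ℓ + 1) ^ k) x (f₁ q) + wsum δ₂ ((ℓ + 1) ^ k) x (f₂ q)) :=
          Finset.sum_le_sum fun q _ => wsum_add_le δ₂ ((ℓ + 1) ^ k) x (f₁ q) (f₂ q)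
      _ = ∑ q : ↥(ctrs P), wsum δ₂ ((ℓ + 1) ^ k) x (f₁ q) + ∑ q : ↥(ctrs P), wsum δ₂ ((ℓ + 1) ^ k) x (f₂ q) := Finset.sum_add_distrib
  refine hsum.trans ?_
  have hc1 := mul_le_mul_of_nonneg_right hcardU hB₁0
  have hc2 := mul_le_mul_of_nonneg_right hcardU hB₂0
  have hB : 0 ≤ (2 ^ (d + 1) + 2 ^ (d + 1)) * (B₁ + B₂) := mul_nonneg (by positivity) (add_nonneg hB₁0 hB₂0)
  linarith

end GZeroDeriv

/-! ## §3 (2.67)₂ along the printed route -/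

section Prop22Deriv

variable {ℓ k Mh : ℕ} {P : Fin (d + 1) → ℕ}

/-- **[B6] PROPOSITION 2.2, SECOND ENTRY OF (2.67) (`∇G′`, «(L^jη)² replaced by L^jη»), FOR THE GENUINE TWO-LEVEL
OPERATOR ON A BOX, ALONG THE PRINTED ROUTE**: there are `δ, M₀, C > 0` (functions of `d`, `ℓ` and the window) such that
for EVERY mesh `k ≥ 1`, `M_h ≥ 3` with `L·M_h ≥ M₀`, volume `P`, block union `Λ`, window point, axis `μ` and fine-lattice
neighbours `x, x + e_μ ∈ Ω`: `Σ_{x′}|n(G′(x+e_μ,x′) − G′(x,x′))|e^{δ|x−x′|_∞/n} ≤ C` for `G′ = (Δ_Ω^{L^{−j},N} + m² +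
Q′*aQ′)^{−1}` — by the differenced fixed-point form of (2.38)/(2.50), the (2.64)-input `wsum_gZero_deriv_le`, the
(2.51)/(2.65)-input `roww_rOp_le` and `wsum(v·R) ≤ wsum(v)·sup roww(R)`.
[cite: Balaban1984PropagatorsII, Proposition 2.2 (2.64)–(2.67) p.234] -/
theorem prop22_entry2_twoLevelBox (d ℓ : ℕ) (hℓ : 1 ≤ ℓ) (aminus aplus m2plus a2minus a2plus : ℝ) (ha : 0 < aminus)
    (ha2 : 0 < a2minus) :
    ∃ δ M₀ C : ℝ, 0 < δ ∧ 0 < M₀ ∧ 0 < C ∧ ∀ (k : ℕ), 1 ≤ k → ∀ (aj m2 a : ℝ), aminus ≤ aj → aj ≤ aplus → 0 ≤ m2 →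
      m2 ≤ m2plus → a2minus ≤ a → a ≤ a2plus → ∀ (Mh : ℕ), 3 ≤ Mh → M₀ ≤ ((ℓ : ℝ) + 1) * Mh →
        ∀ (P : Fin (d + 1) → ℕ), (∀ i, 1 ≤ P i) → ∀ (Λ : Finset ↥(boxDom (fun i => (ℓ + 1) * (Mh * P i)))),
        IsBlockUnion ℓ (fun i => Mh * P i) Λ → ∀ (μ : Fin (d + 1))
        (x xe : ↥(Box d ℓ k (fun i => (ℓ + 1) * (Mh * P i)))), xe.1 = x.1 + Pi.single μ 1 →
          wsum δ ((ℓ + 1) ^ k) x (fun x' => (((ℓ + 1) ^ k : ℕ) : ℝ)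
              * (gTwoLevel ((ℓ + 1) ^ k) ℓ aj a m2 (fun i => Mh * P i) Λ xe x'
                - gTwoLevel ((ℓ + 1) ^ k) ℓ aj a m2 (fun i => Mh * P i) Λ x x')) ≤ C := by
  obtain ⟨δ₁, CR, hδ₁, hCR, hR⟩ := roww_rOp_le d ℓ hℓ aminus aplus m2plus a2minus a2plus ha ha2
  obtain ⟨δ₂, C₀, hδ₂, hC₀, hG0⟩ := wsum_gZero_deriv_le d ℓ hℓ aminus aplus m2plus a2minus a2plus ha ha2
  refine ⟨min δ₁ δ₂, 2 * CR, 2 * C₀, lt_min hδ₁ hδ₂, by positivity, by positivity, ?_⟩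
  intro k hk aj m2 a e1 e2 e3 e4 e5 e6 Mh hMh hM P hP Λ hΛ μ x xe hxe
  have hMh1 : 1 ≤ Mh := le_trans (by norm_num) hMh
  have hδ0 : 0 ≤ min δ₁ δ₂ := (lt_min hδ₁ hδ₂).le
  have hMpos : (0 : ℝ) < ((ℓ : ℝ) + 1) * Mh := by
    have : (3 : ℝ) ≤ Mh := by exact_mod_cast hMh
    have : (0 : ℝ) ≤ ℓ := Nat.cast_nonneg ℓ
    positivity
  set n : ℕ := (ℓ + 1) ^ k with hn
  set G := gTwoLevel ((ℓ + 1) ^ k) ℓ aj a m2 (fun i => Mh * P i) Λ with hG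
  set G₀ := B6Eq250.gZero (hDiag ℓ k Mh P) (gPad ℓ k Mh P aj a m2 Λ hP) with hG₀
  set Rm := B6Eq250.rOp (twoLevelOp ((ℓ + 1) ^ k) ℓ aj a m2 (fun i => Mh * P i) Λ) (hDiag ℓ k Mh P)
    (gPad ℓ k Mh P aj a m2 Λ hP) with hRm
  have hRrow : ∀ x', roww (min δ₁ δ₂) n Rm x' ≤ 1 / 2 := by
    intro x'
    refine (roww_mono (min_le_left _ _) _ _ _).trans ((hR k hk aj m2 a e1 e2 e3 e4 e5 e6 Mh hMh P hP Λ hΛ x').trans ?_)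
    calc CR / (((ℓ : ℝ) + 1) * Mh) ≤ CR / (2 * CR) := div_le_div_of_nonneg_left hCR.le (by positivity) hM
      _ = 1 / 2 := by field_simp
  have hfix : G = G₀ + G * Rm :=
    gTwoLevel_eq_gZero_add hℓ hk hMh1 hP (lt_of_lt_of_le ha e1) (lt_of_lt_of_le ha2 e5) e3 hΛ
  -- the functional over pairs, and the differenced fixed point for an arbitrary pair
  set W : (↥(Box d ℓ k (fun i => (ℓ + 1) * (Mh * P i))) × ↥(Box d ℓ k (fun i => (ℓ + 1) * (Mh * P i)))) → ℝ :=
    fun p => wsum (min δ₁ δ₂) n p.1 (fun x' => (n : ℝ) * (G p.2 x' - G p.1 x')) with hW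
  have hWfix : ∀ p : ↥(Box d ℓ k (fun i => (ℓ + 1) * (Mh * P i))) × ↥(Box d ℓ k (fun i => (ℓ + 1) * (Mh * P i))),
      W p ≤ wsum (min δ₁ δ₂) n p.1 (fun x' => (n : ℝ) * (G₀ p.2 x' - G₀ p.1 x')) + W p * (1 / 2) := by
    intro p
    have hent : ∀ x'', (n : ℝ) * (G p.2 x'' - G p.1 x'')
        = (n : ℝ) * (G₀ p.2 x'' - G₀ p.1 x'') + ∑ x', (n : ℝ) * (G p.2 x' - G p.1 x') * Rm x' x'' := by
      intro x''
      have e2 : G p.2 x'' = G₀ p.2 x'' + ∑ x', G p.2 x' * Rm x' x'' := by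
        conv_lhs => rw [hfix]
        rw [Matrix.add_apply, Matrix.mul_apply]
      have e1 : G p.1 x'' = G₀ p.1 x'' + ∑ x', G p.1 x' * Rm x' x'' := by
        conv_lhs => rw [hfix]
        rw [Matrix.add_apply, Matrix.mul_apply]
      rw [e2, e1]
      have : ∑ x', (n : ℝ) * (G p.2 x' - G p.1 x') * Rm x' x''
          = (n : ℝ) * (∑ x', G p.2 x' * Rm x' x'' - ∑ x', G p.1 x' * Rm x' x'') := by
        rw [← Finset.sum_sub_distrib, Finset.mul_sum]
        exact Finset.sum_congr rfl fun x' _ => by ring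
      rw [this]; ring
    calc W p = wsum (min δ₁ δ₂) n p.1 (fun x'' => (n : ℝ) * (G₀ p.2 x'' - G₀ p.1 x'')
          + ∑ x', (n : ℝ) * (G p.2 x' - G p.1 x') * Rm x' x'') := by
            rw [hW]; exact wsum_congr _ _ _ hent
      _ ≤ wsum (min δ₁ δ₂) n p.1 (fun x' => (n : ℝ) * (G₀ p.2 x' - G₀ p.1 x'))
          + wsum (min δ₁ δ₂) n p.1 (fun x'' => ∑ x', (n : ℝ) * (G p.2 x' - G p.1 x') * Rm x' x'') :=
            wsum_add_le _ _ _ _ _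
      _ ≤ _ := add_le_add le_rfl (wsum_vecMul_le hδ0 n p.1 _ Rm hRrow)
  -- the maximal neighbouring pair
  classical
  set NP := (Finset.univ : Finset (↥(Box d ℓ k (fun i => (ℓ + 1) * (Mh * P i)))
      × ↥(Box d ℓ k (fun i => (ℓ + 1) * (Mh * P i))))).filter (fun p => p.2.1 = p.1.1 + Pi.single μ 1) with hNP
  have hmem : (x, xe) ∈ NP := Finset.mem_filter.2 ⟨Finset.mem_univ _, hxe⟩
  obtain ⟨p₀, hp₀, hmax⟩ := Finset.exists_max_image NP W ⟨(x, xe), hmem⟩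
  have hp₀e : p₀.2.1 = p₀.1.1 + Pi.single μ 1 := (Finset.mem_filter.1 hp₀).2
  have h0 : wsum (min δ₁ δ₂) n p₀.1 (fun x' => (n : ℝ) * (G₀ p₀.2 x' - G₀ p₀.1 x')) ≤ C₀ :=
    (wsum_mono (min_le_right _ _) _ _ _).trans (hG0 k hk aj m2 a e1 e2 e3 e4 e5 e6 Mh hMh1 P hP Λ μ p₀.1 p₀.2 hp₀e)
  have hWp₀ : W p₀ ≤ 2 * C₀ := by
    have := hWfix p₀
    linarith
  have hWx : W (x, xe) ≤ W p₀ := hmax _ hmem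
  have : wsum (min δ₁ δ₂) n x (fun x' => (n : ℝ) * (G xe x' - G x x')) = W (x, xe) := by rw [hW]
  rw [this]
  linarith

/-- **THE PRINTED VALUE FORM OF (2.67)₂**: `|n((G′λ)(x+e_μ) − (G′λ)(x))| ≤ Ce^{−δD/n}F` for `|λ| ≤ F` supported at
sup-distance `≥ D` from `x` («|(∇G′λ)(x)| ≤ O(1)L^jηe^{−½δ₀d(y,y′)}|λ|»), same uniformity.
[cite: Balaban1984PropagatorsII, Proposition 2.2 (2.67) p.234] -/
theorem gTwoLevel_deriv_value_decay (d ℓ : ℕ) (hℓ : 1 ≤ ℓ) (aminus aplus m2plus a2minus a2plus : ℝ) (ha : 0 < aminus)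
    (ha2 : 0 < a2minus) :
    ∃ δ M₀ C : ℝ, 0 < δ ∧ 0 < M₀ ∧ 0 < C ∧ ∀ (k : ℕ), 1 ≤ k → ∀ (aj m2 a : ℝ), aminus ≤ aj → aj ≤ aplus → 0 ≤ m2 →
      m2 ≤ m2plus → a2minus ≤ a → a ≤ a2plus → ∀ (Mh : ℕ), 3 ≤ Mh → M₀ ≤ ((ℓ : ℝ) + 1) * Mh →
        ∀ (P : Fin (d + 1) → ℕ), (∀ i, 1 ≤ P i) → ∀ (Λ : Finset ↥(boxDom (fun i => (ℓ + 1) * (Mh * P i)))),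
        IsBlockUnion ℓ (fun i => Mh * P i) Λ →
        ∀ (f : ↥(Box d ℓ k (fun i => (ℓ + 1) * (Mh * P i))) → ℝ) (F D : ℝ), (∀ x', |f x'| ≤ F) →
        ∀ (μ : Fin (d + 1)) (x xe : ↥(Box d ℓ k (fun i => (ℓ + 1) * (Mh * P i)))), xe.1 = x.1 + Pi.single μ 1 →
          (∀ x', f x' ≠ 0 → D ≤ supNorm (x.1 - x'.1)) →
          |(((ℓ + 1) ^ k : ℕ) : ℝ) * ((gTwoLevel ((ℓ + 1) ^ k) ℓ aj a m2 (fun i => Mh * P i) Λ *ᵥ f) xe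
              - (gTwoLevel ((ℓ + 1) ^ k) ℓ aj a m2 (fun i => Mh * P i) Λ *ᵥ f) x)|
            ≤ C * Real.exp (-(δ * D / (((ℓ + 1) ^ k : ℕ) : ℝ))) * F := by
  obtain ⟨δ, M₀, C, hδ, hM₀, hC, h⟩ := prop22_entry2_twoLevelBox d ℓ hℓ aminus aplus m2plus a2minus a2plus ha ha2
  refine ⟨δ, M₀, C, hδ, hM₀, hC, ?_⟩
  intro k hk aj m2 a e1 e2 e3 e4 e5 e6 Mh hMh hM P hP Λ hΛ f F D hF μ x xe hxe hD
  rw [mulVec_sub_mulVec]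
  exact abs_sum_mul_le_of_wsum hδ.le _ x _ (h k hk aj m2 a e1 e2 e3 e4 e5 e6 Mh hMh hM P hP Λ hΛ μ x xe hxe) f hF hD

end Prop22Deriv

end

end Literature.MathematicalPhysics.QuantumFieldTheory.Balaban1983to89.B6Prop22DerivTwoLevelBox
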